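import Literature.NumberTheory.Sieve.PolynomialCongruences
import Literature.NumberTheory.QuadraticFields.BinaryQuadraticFormsClassNumber
import Mathlib.NumberTheory.ModularForms.CongruenceSubgroups
import HarnessLib

/-!
# Roots of quadratic congruences as binary quadratic forms at level `q` (DFI 1995 §2, any sign)

Topic `Literature/NumberTheory/Sieve`.  Common arithmetic trunk of W. Duke, J. B. Friedlander,
H. Iwaniec, *Equidistribution of roots of a quadratic congruence to prime moduli*, Ann. of Math.
141 (1995), §2 (negative discriminant) and of Á. Tóth, *Roots of quadratic congruences*, IMRN
2000 (positive discriminant): the passage from the Weyl sums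
`ρ_h(n) = ∑_{f(ν) ≡ 0 (mod n)} e(hν/n)` of a quadratic `f = aX² + bX + c` (`a > 0`, any
discriminant `Δ = b² − 4ac`) to integral binary quadratic forms of discriminant `Δ` whose first
coefficient is divisible by the level.  This is "Hooley's idea of relating the solutions of
quadratic congruences to representations of the modulus by quadratic forms" (DFI p. 426) in the
form of DFI's (13) p. 428, written for a general middle coefficient `b` (DFI take `b` even) and
with no sign condition on `Δ` (nothing here uses definiteness):

* `RootForms.polyRootWeylSum_quad` — **DFI (13), first equality**: for `a > 0`, `n ≥ 1`,
  `ρ_h(n) = ∑_B e(h(B − b)/(2an))`, `B` over the residues `mod 2an` with `B² ≡ Δ (mod 4an)`,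
  `B ≡ b (mod 2a)` (`ν ↦ B = 2aν + b`; DFI's `β = aν + b (mod an)` is `B/2` for even `b`);
* `RootForms.rootForm a b c n B = [an, B, (B² − Δ)/(4an)]`, a form of discriminant `Δ`
  (`rootForm_disc`), and the **level set** `RootForms.IsLevelForm a b Δ q Q`
  (`disc Q = Δ`, `q ∣ A`, `B ≡ b (mod 2a)` for `Q = [A, B, C]`), which is stable under the right
  action `Q ↦ Q·γ` of `Γ₀(q)` as soon as `a ∣ q` (`IsLevelForm.smul`) — DFI's
  "the condition `n ≡ 0 (mod d)` is equivalent to `γ_τ ≡ 0 (mod q)`, `q = ad`" (p. 428);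
* `RootForms.smul_T_zpow`, `RootForms.IsTReduced` (`0 ≤ B < 2|A|`) and
  `RootForms.existsUnique_isTReduced`: `Γ∞ = {T^k}` acts by `B ↦ B + 2Ak`, every form with
  `A ≠ 0` has exactly one `T`-reduced translate;
* `RootForms.rootPairsEquiv` — the bijection `(n, B) ↦ rootForm a b c n B` between the pairs
  (`n ≥ 1`, `d ∣ n`, `B` a residue as above) and the `T`-reduced level forms of level `q = ad`
  with `A > 0`; and the resulting finite identity **`RootForms.sum_weylSum_eq_sum_levelForms`**:
  `∑_{n ≤ N, d ∣ n} G(n) ρ_h(n) = ∑_{Q} G(A_Q/a) e(h(B_Q − b)/(2A_Q))` over the `T`-reduced level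
  forms with `0 < A_Q ≤ aN` (`RootForms.levelFormsUpTo`) — the left-hand side of DFI's (14) before
  the forms are grouped into `Γ₀(q)`-classes (Heegner points for `Δ < 0`, closed geodesics for
  `Δ > 0`).

Normalisations: `a > 0` (for `a < 0` use `polyRootWeylSum_neg_poly : ρ_h(−f) = ρ_h(f)` and
`neg_quad`); any `f` with `natDegree f ≤ 2` is `C (f.coeff 2) X² + C (f.coeff 1) X + C (f.coeff 0)`
(`eq_quad_of_natDegree_le_two`).
Everything in this file is proved; no statement of either paper is vendored here.

## References

* W. Duke, J. B. Friedlander, H. Iwaniec, Ann. of Math. (2) 141 (1995), 423–441, §2 pp. 426–428,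
  (11)–(14). [cite: DukeFriedlanderIwaniec1995, §2 (11)–(14)]
* Á. Tóth, *Roots of quadratic congruences*, Internat. Math. Res. Notices 2000, no. 14, 719–739
  — the positive-discriminant theorem resting on the same correspondence (there with closed
  geodesics in place of Heegner points; the paper is cite-only in the store, its use of the
  correspondence is as described in [cite: Ngo2024, §1]). [cite: Toth2000, main theorem]
* C. Hooley, *On the number of divisors of quadratic polynomials*, Acta Math. 110 (1963), 97–114
  — DFI's reference [Ho1] for "relating the solutions of quadratic congruences to representations
  of the modulus by quadratic forms" (DFI p. 426; not re-read here).
  [cite: Hooley1963, as cited in DukeFriedlanderIwaniec1995 p. 426 ([Ho1])]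
* D. A. Cox, *Primes of the form x² + ny²*, 2nd ed. (2013), §2.A (forms, the action
  `f(px + qy, rx + sy)`, discriminant), the source of the tree's `BinQF`. [cite: Cox2013, §2.A]
-/

namespace Literature.NumberTheory.Sieve

open scoped BigOperators Polynomial MatrixGroups
open Finset Polynomial
open Literature.NumberTheory.QuadraticFields.Quadratic (BinQF)

/-- `ρ_h(−f) = ρ_h(f)`: the roots of `−f` and of `f` modulo `n` coincide. [folklore] -/
theorem polyRootWeylSum_neg_poly (f : ℤ[X]) (n : ℕ) (h : ℤ) :
    polyRootWeylSum (-f) n h = polyRootWeylSum f n h := by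
  unfold polyRootWeylSum
  refine Finset.sum_congr ?_ fun _ _ => rfl
  ext ν
  simp only [mem_filter, mem_range, eval_neg, dvd_neg]

namespace RootForms

/-! ### The quadratic `aX² + bX + c` and the residues `B (mod 2an)` -/

/-- `−(aX² + bX + c) = (−a)X² + (−b)X + (−c)` (to normalise `a > 0` via
`polyRootWeylSum_neg_poly`). [folklore] -/
theorem neg_quad (a b c : ℤ) :
    -(C a * X ^ 2 + C b * X + C c : ℤ[X]) = C (-a) * X ^ 2 + C (-b) * X + C (-c) := by
  simp only [map_neg]
  ring

/-- A polynomial of degree `≤ 2` is `aX² + bX + c` with its three coefficients (so the results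
below apply to the `f` of `toth2000_quadraticRoots_primeModuli`). [folklore] -/
theorem eq_quad_of_natDegree_le_two (f : ℤ[X]) (hf : f.natDegree ≤ 2) :
    C (f.coeff 2) * X ^ 2 + C (f.coeff 1) * X + C (f.coeff 0) = f := by
  ext n
  simp only [coeff_add, coeff_C_mul, coeff_X_pow, coeff_X, coeff_C]
  rcases n with _ | _ | _ | n
  · simp
  · simp
  · simp
  · have h3 : f.coeff (n + 3) = 0 := coeff_eq_zero_of_natDegree_lt (by omega)
    simp [h3]

/-- Completing the square: `4a(ax² + bx + c) = (2ax + b)² − Δ`, `Δ = discrim a b c = b² − 4ac`.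
[cite: DukeFriedlanderIwaniec1995, p. 428 ("after completing the square")] -/
theorem four_mul_a_mul_quad (a b c x : ℤ) :
    4 * a * (a * x ^ 2 + b * x + c) = (2 * a * x + b) ^ 2 - discrim a b c := by
  rw [discrim]; ring

/-- **The residues of DFI's (13)**: `B (mod 2an)`, `0 ≤ B < 2an`, with `B² ≡ Δ (mod 4an)` and
`B ≡ b (mod 2a)` (`a > 0` understood).  For `b = 2b'` these are `B = 2β` with DFI's
`β (mod an)`, `β² + D ≡ 0 (mod an)`, `β ≡ b' (mod a)`, `D = −Δ/4`.
[cite: DukeFriedlanderIwaniec1995, (13) p. 428] -/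
noncomputable def residues (a b c : ℤ) (n : ℕ) : Finset ℤ :=
  (Finset.Ico (0 : ℤ) (2 * a * n)).filter
    (fun B => (4 * a * n : ℤ) ∣ B ^ 2 - discrim a b c ∧ (2 * a : ℤ) ∣ B - b)

/-- Membership in `residues`. [folklore] -/
theorem mem_residues {a b c : ℤ} {n : ℕ} {B : ℤ} :
    B ∈ residues a b c n ↔
      (0 ≤ B ∧ B < 2 * a * n) ∧ (4 * a * n : ℤ) ∣ B ^ 2 - discrim a b c ∧ (2 * a : ℤ) ∣ B - b := by
  simp [residues, Finset.mem_filter, Finset.mem_Ico]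

/-- The root set of `aX² + bX + c` modulo `n`, as used by `polyRootWeylSum`. [folklore] -/
theorem mem_filter_roots {a b c : ℤ} {n ν : ℕ} :
    ν ∈ (Finset.range n).filter
        (fun ν : ℕ => (n : ℤ) ∣ (C a * X ^ 2 + C b * X + C c : ℤ[X]).eval (ν : ℤ)) ↔
      ν < n ∧ (n : ℤ) ∣ a * ν ^ 2 + b * ν + c := by
  simp [Finset.mem_filter, Finset.mem_range]

section residues

variable {a b c : ℤ} {n : ℕ}

/-- The map `ν ↦ B = (2aν + b) mod 2an` lands in the residues. [cite: DukeFriedlanderIwaniec1995, (13) p. 428] -/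
theorem toResidue_mem (ha : 0 < a) (hn : 0 < n) {ν : ℤ} (hν : (n : ℤ) ∣ a * ν ^ 2 + b * ν + c) :
    (2 * a * ν + b) % (2 * a * n) ∈ residues a b c n := by
  have hm : (0 : ℤ) < 2 * a * n := by positivity
  set y : ℤ := 2 * a * ν + b with hy
  set t : ℤ := y / (2 * a * n) with ht
  have hdef : y % (2 * a * n) = y - 2 * a * n * t := Int.emod_def y _
  obtain ⟨k, hk⟩ := hν
  refine mem_residues.2 ⟨⟨Int.emod_nonneg _ hm.ne', Int.emod_lt_of_pos _ hm⟩, ?_, ?_⟩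
  · refine ⟨k - y * t + a * n * t ^ 2, ?_⟩
    rw [hdef]
    have h4 := four_mul_a_mul_quad a b c ν
    rw [hk, ← hy] at h4
    linear_combination -h4
  · refine ⟨ν - n * t, ?_⟩
    rw [hdef, hy]
    ring

/-- The map `B ↦ ν = ((B − b)/(2a)) mod n` lands in the roots. [cite: DukeFriedlanderIwaniec1995, (13) p. 428] -/
theorem ofResidue_dvd (ha : 0 < a) {B : ℤ} (hB : B ∈ residues a b c n) :
    (n : ℤ) ∣ a * (((B - b) / (2 * a)) % n) ^ 2 + b * (((B - b) / (2 * a)) % n) + c := by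
  obtain ⟨-, h4, h2⟩ := mem_residues.1 hB
  set ν₀ : ℤ := (B - b) / (2 * a) with hν₀
  have h2a : (2 * a : ℤ) ≠ 0 := by positivity
  have hB' : 2 * a * ν₀ + b = B := by
    rw [hν₀, Int.mul_ediv_cancel' h2]; ring
  -- `n ∣ f(ν₀)` from `4a f(ν₀) = B² − Δ ≡ 0 (mod 4an)`
  have hf₀ : (n : ℤ) ∣ a * ν₀ ^ 2 + b * ν₀ + c := by
    have h4' : (4 * a : ℤ) * n ∣ (4 * a) * (a * ν₀ ^ 2 + b * ν₀ + c) := by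
      rw [four_mul_a_mul_quad, hB']
      simpa [mul_assoc] using h4
    exact Int.dvd_of_mul_dvd_mul_left (by positivity) h4'
  -- `f(ν) ≡ f(ν₀) (mod n)` for `ν = ν₀ mod n`
  set ν : ℤ := ν₀ % n with hν
  have hdiff : ν - ν₀ = -(n * (ν₀ / n)) := by
    rw [hν, Int.emod_def]; ring
  have key : a * ν ^ 2 + b * ν + c = (a * ν₀ ^ 2 + b * ν₀ + c) + (ν - ν₀) * (a * (ν + ν₀) + b) := by
    ring
  rw [key, hdiff]
  exact dvd_add hf₀ (Dvd.dvd.mul_right (dvd_neg.2 (dvd_mul_right _ _)) _)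

/-- **DFI (13), first equality, for a general quadratic.**  For `a > 0` and `n ≥ 1`,
`ρ_h(n) = ∑_{ν mod n, f(ν) ≡ 0} e(hν/n) = ∑_{B} e(h(B − b)/(2an))`, `B` over `residues a b c n`
(the bijection `ν ↦ B = 2aν + b (mod 2an)`). [cite: DukeFriedlanderIwaniec1995, (13) p. 428] -/
theorem polyRootWeylSum_quad (ha : 0 < a) (b c : ℤ) (hn : 0 < n) (h : ℤ) :
    polyRootWeylSum (C a * X ^ 2 + C b * X + C c) n h =
      ∑ B ∈ residues a b c n,
        Complex.exp (2 * Real.pi * Complex.I * ((h : ℂ) * ((B : ℂ) - b) / (2 * a * n))) := by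
  unfold polyRootWeylSum
  have hm : (0 : ℤ) < 2 * a * n := by positivity
  have h2a : (2 * a : ℤ) ≠ 0 := by positivity
  have hn0 : (n : ℤ) ≠ 0 := by exact_mod_cast hn.ne'
  refine Finset.sum_nbij' (fun ν : ℕ => (2 * a * ν + b) % (2 * a * n))
    (fun B : ℤ => (((B - b) / (2 * a)) % n).toNat) ?_ ?_ ?_ ?_ ?_
  · -- `i` maps roots to residues
    intro ν hν
    rw [mem_filter_roots] at hν
    exact toResidue_mem ha hn hν.2
  · -- `j` maps residues to roots
    intro B hB
    rw [mem_filter_roots]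
    have h0 : (0 : ℤ) ≤ ((B - b) / (2 * a)) % n := Int.emod_nonneg _ hn0
    have hcast : (((((B - b) / (2 * a)) % n).toNat : ℕ) : ℤ) = ((B - b) / (2 * a)) % n :=
      Int.toNat_of_nonneg h0
    constructor
    · have : (((((B - b) / (2 * a)) % n).toNat : ℕ) : ℤ) < n := by
        rw [hcast]; exact Int.emod_lt_of_pos _ (by exact_mod_cast hn)
      exact_mod_cast this
    · rw [hcast]
      exact ofResidue_dvd ha hB
  · -- left inverse
    intro ν hν
    rw [mem_filter_roots] at hν
    set y : ℤ := 2 * a * ν + b with hy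
    set t : ℤ := y / (2 * a * n) with ht
    have hdef : y % (2 * a * n) = y - 2 * a * n * t := Int.emod_def y _
    have h1 : (y % (2 * a * n) - b) / (2 * a) = ν - n * t := by
      rw [hdef, hy]
      have : 2 * a * (ν : ℤ) + b - 2 * a * n * t - b = 2 * a * (ν - n * t) := by ring
      rw [this, Int.mul_ediv_cancel_left _ h2a]
    have h2 : ((ν : ℤ) - n * t) % n = ν := by
      have : (ν : ℤ) - n * t = ν + n * (-t) := by ring
      rw [this, Int.add_mul_emod_self_left]
      exact Int.emod_eq_of_lt (by positivity) (by exact_mod_cast hν.1)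
    simp only [h1, h2, Int.toNat_natCast]
  · -- right inverse
    intro B hB
    obtain ⟨⟨hB0, hBm⟩, -, h2⟩ := mem_residues.1 hB
    set ν₀ : ℤ := (B - b) / (2 * a) with hν₀
    have hB' : 2 * a * ν₀ + b = B := by
      rw [hν₀, Int.mul_ediv_cancel' h2]; ring
    have h0 : (0 : ℤ) ≤ ν₀ % n := Int.emod_nonneg _ hn0
    have hcast : (((ν₀ % n).toNat : ℕ) : ℤ) = ν₀ % n := Int.toNat_of_nonneg h0
    rw [hcast, Int.emod_def ν₀ n]
    have : 2 * a * (ν₀ - n * (ν₀ / n)) + b = B + 2 * a * n * (-(ν₀ / n)) := by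
      rw [← hB']; ring
    rw [this, Int.add_mul_emod_self_left]
    exact Int.emod_eq_of_lt hB0 hBm
  · -- the summands agree
    intro ν hν
    rw [mem_filter_roots] at hν
    set y : ℤ := 2 * a * ν + b with hy
    set t : ℤ := y / (2 * a * n) with ht
    have hdef : y % (2 * a * n) = y - 2 * a * n * t := Int.emod_def y _
    rw [hdef]
    have hexp : 2 * (Real.pi : ℂ) * Complex.I *
          ((h : ℂ) * (((y - 2 * a * n * t : ℤ) : ℂ) - b) / (2 * a * n)) =
        2 * Real.pi * Complex.I * ((h : ℂ) * (ν : ℂ) / n) + ((-(h * t) : ℤ) : ℂ) * (2 * Real.pi * Complex.I) := by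
      have ha' : (a : ℂ) ≠ 0 := by exact_mod_cast ha.ne'
      have hn' : (n : ℂ) ≠ 0 := by exact_mod_cast hn.ne'
      rw [hy]
      push_cast
      field_simp
      ring
    rw [hexp, Complex.exp_add, Complex.exp_int_mul_two_pi_mul_I, mul_one]

/-- The same with the phase `e(−hb/(2an))` taken out:
`ρ_h(n) = e(−hb/(2an)) ∑_B e(hB/(2an))` — DFI's `ρ_h(n) e(hb/an) = ∑_β e(hβ/an)`.
[cite: DukeFriedlanderIwaniec1995, (13) p. 428] -/
theorem polyRootWeylSum_quad' (ha : 0 < a) (b c : ℤ) (hn : 0 < n) (h : ℤ) :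
    polyRootWeylSum (C a * X ^ 2 + C b * X + C c) n h =
      Complex.exp (2 * Real.pi * Complex.I * (-((h : ℂ) * b / (2 * a * n)))) *
        ∑ B ∈ residues a b c n,
          Complex.exp (2 * Real.pi * Complex.I * ((h : ℂ) * (B : ℂ) / (2 * a * n))) := by
  rw [polyRootWeylSum_quad ha b c hn h, Finset.mul_sum]
  refine Finset.sum_congr rfl fun B _ => ?_
  rw [← Complex.exp_add]
  congr 1
  ring

end residues

/-! ### The forms `[an, B, (B² − Δ)/(4an)]` -/

section forms

variable {a b c : ℤ} {n : ℕ} {B : ℤ}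

/-- The integral binary quadratic form attached to a residue `B (mod 2an)`:
`rootForm a b c n B = [an, B, (B² − Δ)/(4an)]` (for `B² ≡ Δ (mod 4an)` the last coefficient is an
integer and the discriminant is `Δ`).  For `b` even this is DFI's form `(α, β, γ) = (an, B/2, ·)`
of determinant `D = −Δ/4` attached to the root `ν`, `β = aν + b/2`.
[cite: DukeFriedlanderIwaniec1995, (11)–(13) pp. 427–428] -/
def rootForm (a b c : ℤ) (n : ℕ) (B : ℤ) : BinQF :=
  ⟨a * n, B, (B ^ 2 - discrim a b c) / (4 * a * n)⟩

/-- First coefficient of `rootForm`. [folklore] -/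
@[simp] theorem rootForm_a : (rootForm a b c n B).a = a * n := rfl

/-- Middle coefficient of `rootForm`. [folklore] -/
@[simp] theorem rootForm_b : (rootForm a b c n B).b = B := rfl

/-- Last coefficient of `rootForm`: `4an · C = B² − Δ`. [folklore] -/
theorem rootForm_c_spec (hB : (4 * a * n : ℤ) ∣ B ^ 2 - discrim a b c) :
    4 * (a * n) * (rootForm a b c n B).c = B ^ 2 - discrim a b c := by
  simp only [rootForm]
  rw [show (4 * (a * n) : ℤ) = 4 * a * n by ring, Int.mul_ediv_cancel' hB]

/-- `rootForm a b c n B` has discriminant `Δ = b² − 4ac`. [cite: DukeFriedlanderIwaniec1995, (11) p. 427] -/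
theorem rootForm_disc (hB : (4 * a * n : ℤ) ∣ B ^ 2 - discrim a b c) :
    (rootForm a b c n B).disc = discrim a b c := by
  have h := rootForm_c_spec hB
  simp only [BinQF.disc, rootForm_a, rootForm_b] at h ⊢
  linarith

/-- `rootForm a b c n` is injective in `B`. [folklore] -/
theorem rootForm_injective (a b c : ℤ) (n : ℕ) : Function.Injective (rootForm a b c n) := by
  intro B B' h
  simpa using congrArg BinQF.b h

end forms

/-! ### The right action of `SL₂(ℤ)` on forms and the level set -/

section action

/-- The right action `Q ↦ Q·γ = Q(px + qy, rx + sy)` of `γ = (p q; r s) ∈ SL₂(ℤ)` on integral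
binary quadratic forms (the tree's `BinQF.act` restricted to `SL₂(ℤ)`). [cite: Cox2013, §2.A] -/
def smul (Q : BinQF) (γ : SL(2, ℤ)) : BinQF := Q.act (γ 0 0) (γ 0 1) (γ 1 0) (γ 1 1)

/-- The identity acts trivially. [folklore] -/
@[simp] theorem smul_one (Q : BinQF) : smul Q 1 = Q := by
  simp [smul, BinQF.act_one]

/-- `Q·(γγ') = (Q·γ)·γ'` (a right action). [cite: Cox2013, §2.A] -/
theorem smul_mul (Q : BinQF) (γ γ' : SL(2, ℤ)) : smul Q (γ * γ') = smul (smul Q γ) γ' := by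
  simp only [smul, BinQF.act_act, Matrix.SpecialLinearGroup.coe_mul, Matrix.mul_apply,
    Fin.sum_univ_two]

/-- `Q·γ·γ⁻¹ = Q`. [folklore] -/
@[simp] theorem smul_mul_inv (Q : BinQF) (γ : SL(2, ℤ)) : smul (smul Q γ) γ⁻¹ = Q := by
  rw [← smul_mul, mul_inv_cancel, smul_one]

/-- `Q·γ⁻¹·γ = Q`. [folklore] -/
@[simp] theorem smul_inv_mul (Q : BinQF) (γ : SL(2, ℤ)) : smul (smul Q γ⁻¹) γ = Q := by
  rw [← smul_mul, inv_mul_cancel, smul_one]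

/-- The first coefficient of `Q·γ` is the value `Q(p, r)` at the first column of `γ`.
[cite: Cox2013, §2.A] -/
theorem smul_a (Q : BinQF) (γ : SL(2, ℤ)) : (smul Q γ).a = Q.eval (γ 0 0) (γ 1 0) := rfl

/-- The middle coefficient of `Q·γ`. [cite: Cox2013, §2.A] -/
theorem smul_b (Q : BinQF) (γ : SL(2, ℤ)) :
    (smul Q γ).b = 2 * Q.a * γ 0 0 * γ 0 1 + Q.b * (γ 0 0 * γ 1 1 + γ 0 1 * γ 1 0) +
      2 * Q.c * γ 1 0 * γ 1 1 := rfl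

/-- `SL₂(ℤ)` preserves the discriminant. [cite: Cox2013, §2.A] -/
theorem smul_disc (Q : BinQF) (γ : SL(2, ℤ)) : (smul Q γ).disc = Q.disc := by
  have hdet : γ 0 0 * γ 1 1 - γ 0 1 * γ 1 0 = 1 := by
    have h := γ.det_coe
    rwa [Matrix.det_fin_two] at h
  rw [smul, BinQF.disc_act, hdet, one_pow, one_mul]

/-- `Q·T^k = [A, B + 2Ak, Ak² + Bk + C]`: `Γ∞` translates the middle coefficient by multiples of
`2A`. [cite: Cox2013, §2.A (proof of Thm. 2.8)] -/
theorem smul_T_zpow (Q : BinQF) (k : ℤ) :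
    smul Q (ModularGroup.T ^ k) = ⟨Q.a, Q.b + 2 * Q.a * k, Q.a * k ^ 2 + Q.b * k + Q.c⟩ := by
  rw [← BinQF.act_T, smul]
  have h00 : (ModularGroup.T ^ k) 0 0 = 1 := by
    show (ModularGroup.T ^ k).1 0 0 = 1
    rw [ModularGroup.coe_T_zpow]; rfl
  have h01 : (ModularGroup.T ^ k) 0 1 = k := by
    show (ModularGroup.T ^ k).1 0 1 = k
    rw [ModularGroup.coe_T_zpow]; rfl
  have h10 : (ModularGroup.T ^ k) 1 0 = 0 := by
    show (ModularGroup.T ^ k).1 1 0 = 0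
    rw [ModularGroup.coe_T_zpow]; rfl
  have h11 : (ModularGroup.T ^ k) 1 1 = 1 := by
    show (ModularGroup.T ^ k).1 1 1 = 1
    rw [ModularGroup.coe_T_zpow]; rfl
  rw [h00, h01, h10, h11]

/-- `(Q·T^k).a = Q.a`. [folklore] -/
@[simp] theorem smul_T_zpow_a (Q : BinQF) (k : ℤ) : (smul Q (ModularGroup.T ^ k)).a = Q.a := by
  rw [smul_T_zpow]

/-- `(Q·T^k).b = Q.b + 2 Q.a k`. [folklore] -/
@[simp] theorem smul_T_zpow_b (Q : BinQF) (k : ℤ) :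
    (smul Q (ModularGroup.T ^ k)).b = Q.b + 2 * Q.a * k := by
  rw [smul_T_zpow]

/-- `−1 ∈ SL₂(ℤ)` acts trivially on forms. [folklore] -/
@[simp] theorem smul_neg (Q : BinQF) (γ : SL(2, ℤ)) : smul Q (-γ) = smul Q γ := by
  simp only [smul, Matrix.SpecialLinearGroup.coe_neg, Matrix.neg_apply, BinQF.act]
  ext <;> ring

/-- **The level set `X(a, b, Δ; q)`**: integral forms `Q = [A, B, C]` of discriminant `Δ` with
`q ∣ A` and `B ≡ b (mod 2a)`.  For `q = ad` these are exactly the forms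
`[an, 2aν + b, f(ν)/n]·T^k` attached to the roots `ν (mod n)` of `f = aX² + bX + c` with
`d ∣ n` (`rootPairsEquiv`); DFI's `Λ_{ab}`-orbits with the extra condition `γ_τ ≡ 0 (mod q)`.
[cite: DukeFriedlanderIwaniec1995, (12) p. 427 and p. 428] -/
structure IsLevelForm (a b Δ : ℤ) (q : ℕ) (Q : BinQF) : Prop where
  /-- the discriminant is `Δ` -/
  disc_eq : Q.disc = Δ
  /-- the level divides the first coefficient -/
  level_dvd : (q : ℤ) ∣ Q.a
  /-- the middle coefficient is `≡ b (mod 2a)` -/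
  mid_dvd : 2 * a ∣ Q.b - b

/-- **`Γ₀(q)` preserves the level set** when `a ∣ q`: for `γ = (p q'; r s) ∈ Γ₀(q)` the new first
coefficient `Ap² + Bpr + Cr²` is `≡ 0 (mod q)` with `A` and `r`, and the new middle coefficient
`2Apq' + B(ps + q'r) + 2Crs ≡ B (mod 2a)` since `ps + q'r = 1 + 2q'r` and `a ∣ A, r`.  (DFI:
"the condition `n ≡ 0 (mod d)` is equivalent to `γ_τ ≡ 0 (mod q)`", `q = ad`.)
[cite: DukeFriedlanderIwaniec1995, p. 428] -/
theorem IsLevelForm.smul {a b Δ : ℤ} {q : ℕ} {Q : BinQF} (hQ : IsLevelForm a b Δ q Q)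
    (haq : a ∣ (q : ℤ)) {γ : SL(2, ℤ)} (hγ : γ ∈ CongruenceSubgroup.Gamma0 q) :
    IsLevelForm a b Δ q (RootForms.smul Q γ) := by
  have hr : (q : ℤ) ∣ γ 1 0 := by
    have h := CongruenceSubgroup.Gamma0_mem.1 hγ
    exact (ZMod.intCast_zmod_eq_zero_iff_dvd _ _).1 h
  refine ⟨by rw [smul_disc, hQ.disc_eq], ?_, ?_⟩
  · rw [smul_a, BinQF.eval]
    refine dvd_add (dvd_add (dvd_mul_of_dvd_left hQ.level_dvd _) (hr.mul_left _)) ?_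
    exact (dvd_pow hr two_ne_zero).mul_left _
  · obtain ⟨α, hα⟩ := haq.trans hQ.level_dvd
    obtain ⟨ρ, hρ⟩ := haq.trans hr
    obtain ⟨m, hm⟩ := hQ.mid_dvd
    have hdet : γ 0 0 * γ 1 1 - γ 0 1 * γ 1 0 = 1 := by
      have h := γ.det_coe
      rwa [Matrix.det_fin_two] at h
    refine ⟨m + α * γ 0 0 * γ 0 1 + Q.b * γ 0 1 * ρ + Q.c * ρ * γ 1 1, ?_⟩
    rw [smul_b]
    linear_combination (2 * γ 0 0 * γ 0 1) * hα + (2 * Q.b * γ 0 1 + 2 * Q.c * γ 1 1) * hρ + hm +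
      Q.b * hdet

/-- The level set is also stable under `γ⁻¹` for `γ ∈ Γ₀(q)`. [folklore] -/
theorem IsLevelForm.smul_inv {a b Δ : ℤ} {q : ℕ} {Q : BinQF} (hQ : IsLevelForm a b Δ q Q)
    (haq : a ∣ (q : ℤ)) {γ : SL(2, ℤ)} (hγ : γ ∈ CongruenceSubgroup.Gamma0 q) :
    IsLevelForm a b Δ q (RootForms.smul Q γ⁻¹) :=
  hQ.smul haq (Subgroup.inv_mem _ hγ)

/-- `Q ∈ X ↔ Q·γ ∈ X` for `γ ∈ Γ₀(q)`, `a ∣ q`. [folklore] -/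
theorem isLevelForm_smul_iff {a b Δ : ℤ} {q : ℕ} {Q : BinQF} (haq : a ∣ (q : ℤ)) {γ : SL(2, ℤ)}
    (hγ : γ ∈ CongruenceSubgroup.Gamma0 q) :
    IsLevelForm a b Δ q (smul Q γ) ↔ IsLevelForm a b Δ q Q := by
  refine ⟨fun h => ?_, fun h => h.smul haq hγ⟩
  simpa using h.smul_inv haq hγ

end action

/-! ### `T`-reduced forms: a fundamental domain for `Γ∞ = {T^k}` -/

section treduced

/-- A form `[A, B, C]` is `T`-reduced if `0 ≤ B < 2|A|` (one representative of each
`Γ∞`-orbit `{Q·T^k}` when `A ≠ 0`). [folklore] -/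
def IsTReduced (Q : BinQF) : Prop := 0 ≤ Q.b ∧ Q.b < 2 * |Q.a|

/-- The exponent `k` with `Q·T^k` `T`-reduced: `k = −sign(A) ⌊B/(2|A|)⌋`. [folklore] -/
def tExp (Q : BinQF) : ℤ := -(Int.sign Q.a * (Q.b / (2 * |Q.a|)))

/-- `Q·T^{tExp Q}` has middle coefficient `B mod 2|A|`. [folklore] -/
theorem smul_T_zpow_tExp_b (Q : BinQF) :
    (smul Q (ModularGroup.T ^ tExp Q)).b = Q.b % (2 * |Q.a|) := by
  rw [smul_T_zpow_b, tExp, Int.emod_def]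
  have h : Q.a * Int.sign Q.a = |Q.a| := by
    rw [Int.mul_sign_self, Int.natCast_natAbs]
  linear_combination (-(2 * (Q.b / (2 * |Q.a|)))) * h

/-- **Existence of the `T`-reduced translate** (`A ≠ 0`). [folklore] -/
theorem isTReduced_smul_T_zpow_tExp {Q : BinQF} (hA : Q.a ≠ 0) :
    IsTReduced (smul Q (ModularGroup.T ^ tExp Q)) := by
  have hM : (0 : ℤ) < 2 * |Q.a| := by positivity
  refine ⟨?_, ?_⟩
  · rw [smul_T_zpow_tExp_b]; exact Int.emod_nonneg _ hM.ne'
  · rw [smul_T_zpow_tExp_b, smul_T_zpow_a]; exact Int.emod_lt_of_pos _ hM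

/-- **Uniqueness of the `T`-reduced translate**: if `Q·T^k` and `Q·T^{k'}` are both `T`-reduced
(`A ≠ 0`) then `k = k'` (the middle coefficients differ by `2A(k − k')`, of absolute value `< 2|A|`).
[folklore] -/
theorem T_zpow_unique {Q : BinQF} (hA : Q.a ≠ 0) {k k' : ℤ}
    (hk : IsTReduced (smul Q (ModularGroup.T ^ k))) (hk' : IsTReduced (smul Q (ModularGroup.T ^ k'))) :
    k = k' := by
  obtain ⟨h0, h1⟩ := hk
  obtain ⟨h0', h1'⟩ := hk'
  rw [smul_T_zpow_b] at h0 h0' h1 h1'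
  rw [smul_T_zpow_a] at h1 h1'
  have hlt : |(Q.b + 2 * Q.a * k) - (Q.b + 2 * Q.a * k')| < 2 * |Q.a| :=
    abs_sub_lt_of_nonneg_of_lt h0 h1 h0' h1'
  have heq : (Q.b + 2 * Q.a * k) - (Q.b + 2 * Q.a * k') = (2 * Q.a) * (k - k') := by ring
  rw [heq, abs_mul, abs_mul, abs_two] at hlt
  have hpos : (0 : ℤ) < 2 * |Q.a| := by positivity
  have h2 : |k - k'| < 1 := by
    by_contra hcon
    push Not at hcon
    have : 2 * |Q.a| * 1 ≤ 2 * |Q.a| * |k - k'| := mul_le_mul_of_nonneg_left hcon hpos.le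
    linarith
  have h3 := abs_lt.mp h2
  omega

/-- Every form with `A ≠ 0` has exactly one `T`-reduced `Γ∞`-translate. [folklore] -/
theorem existsUnique_isTReduced {Q : BinQF} (hA : Q.a ≠ 0) :
    ∃! k : ℤ, IsTReduced (smul Q (ModularGroup.T ^ k)) :=
  ⟨tExp Q, isTReduced_smul_T_zpow_tExp hA, fun _ hk => T_zpow_unique hA hk (isTReduced_smul_T_zpow_tExp hA)⟩

/-- A `T`-reduced form is its own reduced translate: `tExp Q = 0`. [folklore] -/
theorem tExp_eq_zero_of_isTReduced {Q : BinQF} (hA : Q.a ≠ 0) (hQ : IsTReduced Q) : tExp Q = 0 :=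
  T_zpow_unique hA (isTReduced_smul_T_zpow_tExp hA) (by simpa using hQ)

end treduced

/-! ### Roots `↔` `T`-reduced level forms -/

section equiv

variable {a b c : ℤ} {d : ℕ}

/-- The pairs `(n, B)`: `n ≥ 1`, `d ∣ n`, `B` a residue modulo `2an` (`residues a b c n`); by
`polyRootWeylSum_quad` these index the roots `ν (mod n)` of `aX² + bX + c`, `d ∣ n`.
[cite: DukeFriedlanderIwaniec1995, (13) p. 428] -/
def RootPair (a b c : ℤ) (d : ℕ) : Type :=
  {p : ℕ × ℤ // 0 < p.1 ∧ d ∣ p.1 ∧ p.2 ∈ residues a b c p.1}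

/-- The `T`-reduced level forms of level `q = ad` with positive first coefficient.
[cite: DukeFriedlanderIwaniec1995, (12)–(14) pp. 427–428] -/
def RedLevelForm (a b c : ℤ) (d : ℕ) : Type :=
  {Q : BinQF // IsLevelForm a b (discrim a b c) (a.toNat * d) Q ∧ 0 < Q.a ∧ IsTReduced Q}

/-- The level `q = ad` as an integer. [folklore] -/
theorem level_cast (ha : 0 < a) (d : ℕ) : ((a.toNat * d : ℕ) : ℤ) = a * d := by
  push_cast
  rw [Int.toNat_of_nonneg ha.le]

/-- `rootForm a b c n B` is a `T`-reduced level form with `A = an > 0`.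
[cite: DukeFriedlanderIwaniec1995, (13) p. 428] -/
theorem rootForm_mem (ha : 0 < a) {n : ℕ} (hn : 0 < n) (hdn : d ∣ n) {B : ℤ}
    (hB : B ∈ residues a b c n) :
    IsLevelForm a b (discrim a b c) (a.toNat * d) (rootForm a b c n B) ∧
      0 < (rootForm a b c n B).a ∧ IsTReduced (rootForm a b c n B) := by
  obtain ⟨⟨hB0, hBm⟩, h4, h2⟩ := mem_residues.1 hB
  have hA : (0 : ℤ) < a * n := by positivity
  refine ⟨⟨rootForm_disc h4, ?_, by simpa using h2⟩, by simpa using hA, ?_⟩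
  · rw [level_cast ha, rootForm_a]
    exact mul_dvd_mul_left a (Int.natCast_dvd_natCast.2 hdn)
  · refine ⟨by simpa using hB0, ?_⟩
    rw [rootForm_a, rootForm_b, abs_of_pos hA, ← mul_assoc]
    exact hBm

/-- A level form of level `ad` with `A > 0` has `A = an` with `n = A/a ≥ 1`, `d ∣ n`, and its
middle coefficient is a residue modulo `2an` when the form is `T`-reduced.
[cite: DukeFriedlanderIwaniec1995, (13) p. 428] -/
theorem index_spec (ha : 0 < a) {Q : BinQF} (hQ : IsLevelForm a b (discrim a b c) (a.toNat * d) Q)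
    (hA : 0 < Q.a) :
    a * (((Q.a / a).toNat : ℕ) : ℤ) = Q.a ∧ 0 < (Q.a / a).toNat ∧ d ∣ (Q.a / a).toNat := by
  have hlev := hQ.level_dvd
  rw [level_cast ha] at hlev
  obtain ⟨n₀, hn₀⟩ : a ∣ Q.a := (dvd_mul_right a d).trans hlev
  have hdiv : Q.a / a = n₀ := by rw [hn₀, Int.mul_ediv_cancel_left _ ha.ne']
  have hn₀pos : 0 < n₀ := by
    rw [hn₀] at hA
    exact pos_of_mul_pos_right hA ha.le
  have hcast : (((Q.a / a).toNat : ℕ) : ℤ) = n₀ := by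
    rw [hdiv, Int.toNat_of_nonneg hn₀pos.le]
  refine ⟨by rw [hcast, hn₀], ?_, ?_⟩
  · have : (0 : ℤ) < ((Q.a / a).toNat : ℕ) := by rw [hcast]; exact hn₀pos
    exact_mod_cast this
  · have hd : (d : ℤ) ∣ n₀ := by
      rw [hn₀] at hlev
      exact Int.dvd_of_mul_dvd_mul_left ha.ne' hlev
    rw [← hcast] at hd
    exact Int.natCast_dvd_natCast.1 hd

/-- The middle coefficient of a `T`-reduced level form with `A = an > 0` is a residue modulo
`2an`. [cite: DukeFriedlanderIwaniec1995, (13) p. 428] -/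
theorem b_mem_residues (ha : 0 < a) {Q : BinQF}
    (hQ : IsLevelForm a b (discrim a b c) (a.toNat * d) Q) (hA : 0 < Q.a) (hT : IsTReduced Q) :
    Q.b ∈ residues a b c (Q.a / a).toNat := by
  obtain ⟨hn, -, -⟩ := index_spec ha hQ hA
  refine mem_residues.2 ⟨?_, ?_, hQ.mid_dvd⟩
  · rw [mul_assoc, hn, ← abs_of_pos hA]
    exact hT
  · rw [mul_assoc, hn]
    refine ⟨Q.c, ?_⟩
    have hd := hQ.disc_eq
    rw [BinQF.disc] at hd
    linarith

/-- **Roots `↔` level forms.**  For `a > 0` the map `(n, B) ↦ [an, B, (B² − Δ)/(4an)]` is a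
bijection from the pairs (`n ≥ 1`, `d ∣ n`, `B (mod 2an)` with `B² ≡ Δ (4an)`, `B ≡ b (2a)`) —
equivalently (`polyRootWeylSum_quad`) the roots `ν (mod n)` of `aX² + bX + c` with `d ∣ n` —
onto the `T`-reduced forms of discriminant `Δ` with `ad ∣ A`, `A > 0`, `B ≡ b (mod 2a)`; the
inverse is `Q ↦ (A/a, B)`.  This is the one-to-one correspondence behind DFI's (13)–(14)
(there for `Δ < 0`, `b` even), valid for every `Δ`. [cite: DukeFriedlanderIwaniec1995, §2 pp. 427–428] -/
noncomputable def rootPairsEquiv (ha : 0 < a) (b c : ℤ) (d : ℕ) :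
    RootPair a b c d ≃ RedLevelForm a b c d where
  toFun p := ⟨rootForm a b c p.1.1 p.1.2, rootForm_mem ha p.2.1 p.2.2.1 p.2.2.2⟩
  invFun Q := ⟨((Q.1.a / a).toNat, Q.1.b),
    ⟨(index_spec ha Q.2.1 Q.2.2.1).2.1, (index_spec ha Q.2.1 Q.2.2.1).2.2,
      b_mem_residues ha Q.2.1 Q.2.2.1 Q.2.2.2⟩⟩
  left_inv p := by
    rcases p with ⟨⟨n, B⟩, hn, hdn, hB⟩
    apply Subtype.ext
    simp only [rootForm_a, rootForm_b, Prod.mk.injEq, and_true]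
    rw [Int.mul_ediv_cancel_left _ ha.ne', Int.toNat_natCast]
  right_inv Q := by
    rcases Q with ⟨Q, hQ, hA, hT⟩
    apply Subtype.ext
    obtain ⟨hn, -, -⟩ := index_spec ha hQ hA
    have hd := hQ.disc_eq
    rw [BinQF.disc] at hd
    simp only
    ext
    · rw [rootForm_a, hn]
    · rfl
    · simp only [rootForm]
      rw [mul_assoc, hn, show Q.b ^ 2 - discrim a b c = (4 * Q.a) * Q.c by linarith,
        Int.mul_ediv_cancel_left _ (by positivity : (4 * Q.a : ℤ) ≠ 0)]

/-- The form attached to `(n, B)` under `rootPairsEquiv`. [folklore] -/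
@[simp] theorem rootPairsEquiv_apply (ha : 0 < a) (p : RootPair a b c d) :
    (rootPairsEquiv ha b c d p).1 = rootForm a b c p.1.1 p.1.2 := rfl

end equiv

/-! ### The sum over roots as a sum over level forms -/

section sums

variable {a : ℤ}

/-- The modulus `n = A/a` of a level form (as a natural number). [folklore] -/
def index (a : ℤ) (Q : BinQF) : ℕ := (Q.a / a).toNat

/-- `index a (rootForm a b c n B) = n`. [folklore] -/
@[simp] theorem index_rootForm (ha : 0 < a) (b c : ℤ) (n : ℕ) (B : ℤ) :
    index a (rootForm a b c n B) = n := by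
  rw [index, rootForm_a, Int.mul_ediv_cancel_left _ ha.ne', Int.toNat_natCast]

/-- The `T`-reduced level forms of level `ad` with `0 < A ≤ aN`, as a finite set: the union over
`1 ≤ n ≤ N`, `d ∣ n`, of the forms `rootForm a b c n B`, `B ∈ residues a b c n`.
[cite: DukeFriedlanderIwaniec1995, (14) p. 428] -/
noncomputable def levelFormsUpTo (a b c : ℤ) (d N : ℕ) : Finset BinQF :=
  ((Finset.Icc 1 N).filter (d ∣ ·)).biUnion (fun n => (residues a b c n).image (rootForm a b c n))

/-- Membership in `levelFormsUpTo`: the `T`-reduced level forms with `0 < A ≤ aN`.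
[cite: DukeFriedlanderIwaniec1995, (14) p. 428] -/
theorem mem_levelFormsUpTo (ha : 0 < a) {b c : ℤ} {d N : ℕ} {Q : BinQF} :
    Q ∈ levelFormsUpTo a b c d N ↔
      IsLevelForm a b (discrim a b c) (a.toNat * d) Q ∧ 0 < Q.a ∧ Q.a ≤ a * N ∧ IsTReduced Q := by
  simp only [levelFormsUpTo, Finset.mem_biUnion, Finset.mem_image, Finset.mem_filter,
    Finset.mem_Icc]
  constructor
  · rintro ⟨n, ⟨⟨hn1, hnN⟩, hdn⟩, B, hB, rfl⟩
    obtain ⟨h1, h2, h3⟩ := rootForm_mem (d := d) ha (by omega) hdn hB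
    refine ⟨h1, h2, ?_, h3⟩
    rw [rootForm_a]
    exact mul_le_mul_of_nonneg_left (by exact_mod_cast hnN) ha.le
  · rintro ⟨hQ, hA, hAX, hT⟩
    obtain ⟨hn, hnpos, hdn⟩ := index_spec ha hQ hA
    refine ⟨(Q.a / a).toNat, ⟨⟨hnpos, ?_⟩, hdn⟩, Q.b, b_mem_residues ha hQ hA hT, ?_⟩
    · have : a * (((Q.a / a).toNat : ℕ) : ℤ) ≤ a * N := by rw [hn]; exact hAX
      exact_mod_cast le_of_mul_le_mul_left this ha
    · have e := congrArg Subtype.val ((rootPairsEquiv ha b c d).right_inv ⟨Q, hQ, hA, hT⟩)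
      exact e

/-- **The Weyl sums over `n ≤ N`, `d ∣ n`, as a sum over level forms** (the left-hand side of
DFI's (14), before grouping into `Γ₀(q)`-classes): for `a > 0` and any `G`,
`∑_{n ≤ N, d ∣ n} G(n) ρ_h(n) = ∑_Q G(A_Q/a) e(h(B_Q − b)/(2A_Q))`, `Q` over the `T`-reduced forms
of discriminant `Δ` with `ad ∣ A_Q`, `0 < A_Q ≤ aN`, `B_Q ≡ b (mod 2a)`.
[cite: DukeFriedlanderIwaniec1995, (13)–(14) p. 428] -/
theorem sum_weylSum_eq_sum_levelForms (ha : 0 < a) (b c : ℤ) (d N : ℕ) (h : ℤ) (G : ℕ → ℂ) :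
    ∑ n ∈ (Finset.Icc 1 N).filter (d ∣ ·), G n * polyRootWeylSum (C a * X ^ 2 + C b * X + C c) n h =
      ∑ Q ∈ levelFormsUpTo a b c d N,
        G (index a Q) *
          Complex.exp (2 * Real.pi * Complex.I * ((h : ℂ) * ((Q.b : ℂ) - b) / (2 * (Q.a : ℂ)))) := by
  rw [levelFormsUpTo, Finset.sum_biUnion]
  · refine Finset.sum_congr rfl fun n hn => ?_
    simp only [Finset.mem_filter, Finset.mem_Icc] at hn
    have hn0 : 0 < n := by omega
    rw [Finset.sum_image fun B _ B' _ e => rootForm_injective a b c n e,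
      polyRootWeylSum_quad ha b c hn0 h, Finset.mul_sum]
    refine Finset.sum_congr rfl fun B _ => ?_
    simp only [index_rootForm ha, rootForm_a, rootForm_b, Int.cast_mul, Int.cast_natCast]
    ring_nf
  · -- the pieces for different `n` are disjoint (different first coefficients `an`)
    intro n hn n' hn' hne
    simp only [Finset.coe_filter, Set.mem_setOf_eq] at hn hn'
    rw [Function.onFun, Finset.disjoint_left]
    intro Q hQ hQ'
    simp only [Finset.mem_image] at hQ hQ'
    obtain ⟨B, -, rfl⟩ := hQ
    obtain ⟨B', -, e⟩ := hQ'
    have := congrArg BinQF.a e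
    simp only [rootForm_a] at this
    have : (n' : ℤ) = n := by exact_mod_cast mul_left_cancel₀ ha.ne' this
    exact hne (by exact_mod_cast this.symm)

end sums

end RootForms

end Literature.NumberTheory.Sieve
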